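import Mathlib.RingTheory.DedekindDomain.Ideal.Lemmas
import HarnessLib

/-!
# Maps on a fractional ideal and on its inverse whose product is the multiplication are scalar, and the ideal is principal

Topic `RingTheory/DedekindDomain`; namespace `Literature.RingTheory.DedekindDomain`.  THEOREMS ONLY (Mathlib-only imports;
no definition, no named fact).

Let `R` be a Dedekind domain with fraction field `K`, `I ≠ 0` a fractional ideal, and `γ₀, γ₁ : K → K` two FUNCTIONS (no
linearity assumed) with `γ₀(x) · γ₁(y) = x · y` for all `x ∈ I`, `y ∈ I⁻¹`.  Then there is `g ∈ K^×` with `γ₀ = g·` on `I` and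
`γ₁ = g⁻¹·` on `I⁻¹` (`exists_ne_zero_forall_eq_mul`); if moreover `γ₀(I) ⊆ R` and `γ₁(I⁻¹) ⊆ R` then `g ∈ I⁻¹`, `g⁻¹ ∈ I`
and hence **`I = (g⁻¹)` is principal** (`eq_spanSingleton_inv_of_forall_mul_eq`).  This is the ideal-theoretic core of the
comparison of two principal CM structures of the same type through their `a`-multiplications ([Shimura1998] §7.4,
Prop. 15–16: `Hom((A, ι), (A′, ι′))` «corresponds to» `𝔞′𝔞⁻¹`-multiplications, and two lattices `𝔞, 𝔟` give isomorphic
structures iff `𝔟 = g𝔞`), used in the cell `hodgecm-mathlib` (fan B, row II-1, stub S3 `stub_identification` of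
[Shimura1998] Thm. 18.6 (2), print step p. 129–130) with `γ₀, γ₁` the scalars by which reduced `a`-multiplications act.
HC_CM is proved only modulo the 7 printed citations until rung 0 closes; this file is unconditional and elementary.
-/

namespace Literature.RingTheory.DedekindDomain

open scoped nonZeroDivisors
open FractionalIdeal

variable {R : Type*} [CommRing R] [IsDedekindDomain R] {K : Type*} [Field K] [Algebra R K] [IsFractionRing R K]

/-- A non-zero fractional ideal of a domain contains a non-zero element (Mathlib's `exists_ne_zero_mem_isInteger`, as an
element of `K`). [cite: Shimura1998, §7.4 Prop. 15–16, p. 58 (use)] -/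
theorem FractionalIdeal.exists_mem_ne_zero {I : FractionalIdeal R⁰ K} (hI : I ≠ 0) : ∃ x ∈ I, x ≠ 0 := by
  obtain ⟨r, hr, hrI⟩ := FractionalIdeal.exists_ne_zero_mem_isInteger hI
  exact ⟨algebraMap R K r, hrI, fun h => hr ((map_eq_zero_iff _ (IsFractionRing.injective R K)).1 h)⟩

/-- **Two functions `γ₀` on `I` and `γ₁` on `I⁻¹` with `γ₀(x) γ₁(y) = x y` are the scalars `g` and `g⁻¹`** for a unique
`g ∈ K^×` (`I ≠ 0` a fractional ideal of a Dedekind domain; no linearity is assumed — it follows): fix `y₀ ∈ I⁻¹`,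
`y₀ ≠ 0`; then `γ₁(y₀) ≠ 0` and `γ₀(x) = (y₀ / γ₁(y₀)) x`; symmetrically for `γ₁`. [cite: Shimura1998, §7.4 Prop. 15–16, p. 58 (ideal-theoretic core)] -/
theorem FractionalIdeal.exists_ne_zero_forall_eq_mul {I : FractionalIdeal R⁰ K} (hI : I ≠ 0) (γ₀ γ₁ : K → K)
    (hmul : ∀ x ∈ I, ∀ y ∈ I⁻¹, γ₀ x * γ₁ y = x * y) :
    ∃ g : K, g ≠ 0 ∧ (∀ x ∈ I, γ₀ x = g * x) ∧ ∀ y ∈ I⁻¹, γ₁ y = g⁻¹ * y := by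
  obtain ⟨x₀, hx₀I, hx₀⟩ := FractionalIdeal.exists_mem_ne_zero hI
  obtain ⟨y₀, hy₀I, hy₀⟩ := FractionalIdeal.exists_mem_ne_zero (inv_ne_zero hI)
  have h00 := hmul x₀ hx₀I y₀ hy₀I
  have hγ₁y₀ : γ₁ y₀ ≠ 0 := by
    intro h
    rw [h, mul_zero] at h00
    exact mul_ne_zero hx₀ hy₀ h00.symm
  have hγ₀x₀ : γ₀ x₀ ≠ 0 := by
    intro h
    rw [h, zero_mul] at h00
    exact mul_ne_zero hx₀ hy₀ h00.symm
  refine ⟨y₀ / γ₁ y₀, div_ne_zero hy₀ hγ₁y₀, fun x hx => ?_, fun y hy => ?_⟩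
  · have h := hmul x hx y₀ hy₀I
    field_simp
    linear_combination h
  · have h := hmul x₀ hx₀I y hy
    have h0 : γ₀ x₀ = y₀ / γ₁ y₀ * x₀ := by
      have h' := hmul x₀ hx₀I y₀ hy₀I
      field_simp
      linear_combination h'
    rw [h0] at h
    field_simp at h
    field_simp
    linear_combination h

/-- **… and if `γ₀(I) ⊆ R`, `γ₁(I⁻¹) ⊆ R`, then `I = (g⁻¹)` is PRINCIPAL**, with `γ₀ = g·` on `I` and `γ₁ = g⁻¹·` on `I⁻¹`:
`g I ⊆ R` gives `I ⊆ g⁻¹R`, and `g⁻¹ I⁻¹ ⊆ R` gives `g⁻¹ ∈ (I⁻¹)⁻¹ = I`.  (For `I = 𝔞⁻¹𝔟`: `𝔟 = g⁻¹𝔞` — two lattices whose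
mutual `a`-multiplications reduce to scalars with product `cc′` are homothetic.) [cite: Shimura1998, §7.4 Prop. 15–16, p. 58 (ideal-theoretic core)] -/
theorem FractionalIdeal.eq_spanSingleton_inv_of_forall_mul_eq {I : FractionalIdeal R⁰ K} (hI : I ≠ 0) (γ₀ γ₁ : K → K)
    (hmul : ∀ x ∈ I, ∀ y ∈ I⁻¹, γ₀ x * γ₁ y = x * y)
    (h₀ : ∀ x ∈ I, γ₀ x ∈ (1 : FractionalIdeal R⁰ K)) (h₁ : ∀ y ∈ I⁻¹, γ₁ y ∈ (1 : FractionalIdeal R⁰ K)) :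
    ∃ g : K, g ≠ 0 ∧ I = spanSingleton R⁰ g⁻¹ ∧ (∀ x ∈ I, γ₀ x = g * x) ∧ ∀ y ∈ I⁻¹, γ₁ y = g⁻¹ * y := by
  obtain ⟨g, hg, hγ₀, hγ₁⟩ := FractionalIdeal.exists_ne_zero_forall_eq_mul hI γ₀ γ₁ hmul
  refine ⟨g, hg, le_antisymm ?_ ?_, hγ₀, hγ₁⟩
  · intro x hx
    have hgx : g * x ∈ (1 : FractionalIdeal R⁰ K) := hγ₀ x hx ▸ h₀ x hx
    rw [FractionalIdeal.mem_one_iff] at hgx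
    obtain ⟨r, hr⟩ := hgx
    rw [FractionalIdeal.mem_spanSingleton]
    refine ⟨r, ?_⟩
    rw [Algebra.smul_def, hr, mul_comm g x, mul_assoc, mul_inv_cancel₀ hg, mul_one]
  · rw [FractionalIdeal.spanSingleton_le_iff_mem, ← inv_inv I, FractionalIdeal.mem_inv_iff (inv_ne_zero hI)]
    intro y hy
    exact hγ₁ y hy ▸ h₁ y hy

end Literature.RingTheory.DedekindDomain
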